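import Mathlib
import HarnessLib
import HarnessLib.Audit
import Summits.PneNP.Statement
import Literature.Computability.Complexity.ConstantDepth
import Literature.Computability.Complexity.Nondeterministic
import Literature.Computability.Complexity.CircuitClasses
import Literature.Computability.Complexity.ClayProblem
import Literature.Computability.Complexity.NPBridge
import Literature.Computability.Complexity.CircuitClassesUniformProofs
import Summits.PneNP.PneNP.Theorems.CircuitAssemblyStandalone
import HarnessLib.Audit.Status.Attr

/-!
Route: circuit

DORMANT since 2026-08-25T10:02:57Z (reconciler: no traction for 7.6 d (last activity item-evidence-added at 2026-08-17T19:10:44Z); parked, not closed — `ledger route dormant route-PneNP-circuit --off` to reactivate) — unstaffed, not closed; items shared with open routes are served there. `ledger route dormant <id> --off` reactivates.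

# Route PneNP/circuit — non-uniform lower bounds (NP ⊄ P/poly)

## Thesis X (it suffices to show)
In words: some language in NP has no polynomial-size family of Boolean (B₂) circuits — NP ⊄ P/poly
(Cook, Clay problem
description §3; the Karp–Lipton 1980 question "is SAT in P/poly?"; AroraBarak2009 §6.4).
Lean: `¬ (Literature.Computability.Complexity.Nondeterministic.NP ⊆
Literature.Computability.Complexity.PPoly)`
(item `CircuitThesis`, target, rank 0; by `Iff.rfl` the named open conjecture
`Literature.Computability.Complexity.NPNotSubsetPPoly`
of ClayProblem.lean and the negation of the kill-switch item `CircuitNeg`).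

## Assembly X → PneNP (deciding theorem, D-0027 §2.1)
`theorem closes (hX : CircuitThesis) : PneNP` is PROVED in this file (route-repair 2026-08-15): from
`¬ PneNP` get
`PNPWave0.NP Bool ⊆ PNPWave0.P Bool`, transport along the two model bridges — `P_bool_eq_holds :
PNPWave0.P Bool = Classes.P`
(ClayProblem.lean) and `np_bool_eq : PNPWave0.NP Bool = Nondeterministic.NP` (NPBridge.lean, =
`NP_bool_eq_holds`) — and compose
with `P_subset_PPoly_holds : Classes.P ⊆ PPoly` (CircuitClassesUniformProofs.lean; AroraBarak2009
Thm 6.6) to contradict `hX`.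
Eleven lines; axioms propext / Classical.choice / Quot.sound; its only hypothesis is the route's own
target item, so the route
literally decides the sub-problem: any Theorems-file proof of `CircuitThesis` closes `PneNP`. The
former item `Assembly`
(`P_bool_eq → NP_bool_eq → P_subset_PPoly → NPNotSubsetPPoly → PneNP`, stmt-PneNP-0035) is dropped
as superseded by `closes`.

## Waypoints (implied by X; the ranked cruxes are in the rationale)
X → #2 `CircuitSuperlinear` (an eventual c·n bound puts L in SIZE(c·n + C) ⊆ PPoly:
`mem_SIZE_iff_circuitSize_le_holds`,
`SIZE_subset_PPoly`); X → #4 `CircuitFixedPoly` in Kannan form (`SIZE_subset_PPoly` with p = c·X^k +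
c; checked rc 0 in the
planner's Sketch); X → #5 `CircuitNpTc0` → #3 `CircuitNpAcc0` (`ACC0_subset_TC0_holds`,
`TC0_subset_NC1_holds`, `NC1_subset_PPoly`).
#4 does NOT formally give #2 (the witness L_k may vary with k): independent frontier bits.

## Cone (route-repair 2026-08-15)
Imports: ConstantDepth, Nondeterministic, CircuitClasses, ClayProblem, NPBridge,
CircuitClassesUniformProofs. The dependency cone
of the items is vocabulary only (NP, PPoly, SIZE, ACC0, TC0, Language.circuitSize, …: 58 project
constants and no witness-less
closed Prop among them in the planner's Sketch audit, #h21_route_deps); the open conjecture constant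
`NPNotSubsetPPoly` and the bridge facts no longer occur in any item
statement — they were the phantom "unproved cone facts" that kept the route unstaffed.

Rationale: WHY THIS LINE. Non-uniform circuit lower bounds are the one line on which unconditional progress
against general computation
exists, and P ⊆ P/poly (AroraBarak2009 Thm 6.6, proved in-tree) makes NP ⊄ P/poly sufficient for P ≠
NP (the deciding theorem
`closes`, eleven lines). The published frontier sits one notch below each crux: explicit B₂-size
3.1n − o(n) for affine
dispersers (LiYang2022 Thm 1.1 = in-tree li_yang_holds; STOC2022), restricted-depth separations
PARITY ∉ AC⁰ (FurstSaxeSipser1984, Hastad1986), NEXP ⊄ ACC⁰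
(Williams2014 = williams_acc_holds; ACM2014) and NQP ⊄ ACC⁰∘THR (MurrayWilliams2018 Thms 1.1–1.3),
fixed-polynomial bounds one
level up, Σ₂ᵖ ∩ Π₂ᵖ ⊄ SIZE(O(n^k)) (Kannan1982 Thm 2 = kannan_holds). What is imported is finite
combinatorics, the polynomial
method and Williams' algorithms-to-lower-bounds paradigm rather than machine simulation, so
relativization
(BakerGillSolovay1975) does not bite; natural proofs (RazborovRudich1997) and algebrization
(AaronsonWigderson2009) do, as
filters on METHODS (see Barriers), not on the statements filed. No physical or probabilistic analogy
is imported; the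
route is the frontier-tracking reference ladder the mechanism routes (Circuit2/MCSP, magnification,
proof complexity) plug into.

RANKED CRUXES. #2 CircuitSuperlinear — some NP language has B₂-circuit size not O(n): ∃ L ∈ NP, ∀ c,
∃ᶠ n, c·n <
circuitSize L n (why it might fail: NP ⊆ SIZE(O(n)) is consistent with everything known, frontier
3.1n − o(n), and gate
elimination provably stalls at c·n, GolovnevHirschKnopKulikov2016 Lem 1/Cor 7; sources LiYang2022,
AroraBarak2009 p.343).
#3 CircuitNpAcc0 — ¬ (NP ⊆ ACC⁰) (why it might fail: the algorithmic method diagonalises through the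
NTIME hierarchy and
bottoms out at NQP, MurrayWilliams2018 Thm 1.3; sources Williams2014 Thm 1.1, MurrayWilliams2018).
#5 CircuitNpTc0 — ¬ (NP ⊆
TC⁰) (why it might fail: even NEXP ⊄ TC⁰ is open and TC⁰ evaluates Naor–Reingold PRFs, so nothing
natural works,
NaorReingold2004 p.7; sources RazborovRudich1997, MurrayWilliams2018 Thm 1.3). Ranks: 2 = the most
informative single bit
(any ω(n) bound for NP breaks a fifty-year wall); 3 above 5 because ACC⁰-SAT algorithms exist and
TC⁰-SAT algorithms do not.

KILL CRITERIA. CircuitNeg (NP ⊆ P/poly, support rank 6, filed so the negative side is staffed)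
proved closes the route
outright (and collapses PH to Σ₂ᵖ, KarpLipton1980 = karp_lipton_holds). A Literature theorem that
every proof of #2 must be
Razborov–Rudich natural, together with OWF, closes #2 as a method and pivots the route to the depth
cruxes #3/#5 only. If
#3 is proved but only by NQP-style easy-witness arguments that provably do not scale to TC⁰, re-rank
#5 to 2. A refuter
showing that a filed form is degenerate (as happened to the literal SIZE(n^k) form of #4,
Theorems/CircuitRefutations.lean)
forces a restate, not a close.

NOT DECOMPOSED YET. Deliberately no choice of the explicit hard function (SAT vs MCSP vs affine
dispersers), no
gate-elimination vs polynomial-method split under #2, no formula-size branch (KRW / the n³ shrinkage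
barrier), no uniform vs
non-uniform ACC⁰ distinction under #3, no magnification sub-route (Locality barrier) — these open as
glued splits only after
one of #2, #3, #5 settles or a census names the missing lemma.

CHEAPEST FALSIFIER. X itself has no cheap kill (¬X is a collapse nobody can prove); the cheap checks
are on the FILED FORMS:
(i) every waypoint must follow from X in a few lines over tree facts — X → CircuitFixedPoly
(SIZE_subset_PPoly; done, rc 0),
X → CircuitSuperlinear (mem_SIZE_iff_circuitSize_le_holds + SIZE_subset_PPoly), X → CircuitNpTc0 →
CircuitNpAcc0
(ACC0_subset_TC0_holds, TC0_subset_NC1_holds, NC1_subset_PPoly); a refuter who cannot close one of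
these within the hour has
found a misstatement — exactly how the literal SIZE(n^k) form of #4 died (SIZE_pow_eq_empty); (ii)
vacuity probes: #2 must
fail for every L ∈ SIZE(O(n)) and #4 for every L ∈ P (P ⊆ SIZE(poly)), i.e. the quantifiers are the
intended way round.

SUPPORT. #4 CircuitFixedPoly (rank 4) — Kannan form ∀ k, ∃ L ∈ NP, L ∉ ⋃ c, SIZE(c·n^k + c) (open
for NP; Kannan1982 for
Σ₂ᵖ ∩ Π₂ᵖ; Fortnow–Santhanam–Williams doi:10.1109/ccc.2009.21 for S₂P/PP/MA; HiraharaLuRen2023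
p.10). #6 CircuitNeg (rank 6)
— NP ⊆ P/poly, the negation of X. The deciding theorem `closes : CircuitThesis → PneNP` is proved in
the route file; there is
no separate assembly item any more.

SOURCES. CookClay2006, KarpLipton1980, Kannan1982, FurstSaxeSipser1984, Hastad1986, Razborov1987,
Smolensky1987, ACM2014, Williams2014, MurrayWilliams2018, STOC2022, LiYang2022,
RazborovRudich1997, AaronsonWigderson2009, BakerGillSolovay1975, NaorReingold2004,
GolovnevHirschKnopKulikov2016,
HiraharaLuRen2023, AroraBarak2009, Jukna2012, arXiv:2503.24061, arXiv:1911.08297.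

Novelty: NOVELTY (retriage audit 2026-08-14; search-before-claim: `lit frontier PneNP --since 2020`, `lit
bridges PneNP --cross any`, 4 × `lit search --hybrid`, `lit read` of MurrayWilliams2018
(pp.2,4,13–15), LiYang2022 (pp.2–4), Williams2014 (p.7), HiraharaLuRen2023 (p.10), arXiv:2503.24061
(§1.1–1.2); barrier catalogue Literature/Barriers/PneNP/*).
Nearest prior art: the line IS the textbook non-uniform programme — NP ⊄ P/poly as the road to P ≠
NP (AroraBarak2009 §6.4 PDF p.144, Ch.14, Ch.23; Jukna2012 Thms 20.10–20.13) — and the cruxes are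
its published frontier, one notch up each: B₂-size 3.1n−o(n) for affine dispersers (LiYang2022 Thm
1.1, doi:10.1145/3519935.3519976) vs crux #2 ω(n); NQP ⊄ ACC⁰∘THR by the algorithmic method
(Williams2014 Thm 1.1; MurrayWilliams2018 Thms 1.1–1.3, doi:10.1145/3188745.3188910) vs crux #3 NP ⊄
ACC⁰ and crux #5 NP ⊄ TC⁰; fixed-polynomial bounds for Σ₂∩Π₂ / S₂P / PP / pr-MA (Kannan1982 Thm 2;
Fortnow–Santhanam–Williams doi:10.1109/ccc.2009.21) vs #4 for NP. Newest restatement of the same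
frontier: arXiv:2503.24061 §1.1 ("not even fixed-polynomial size lower bounds are known, not even
for NE and formulas"), which also links #2-type and #4-type statements by hardness magnification
(cf. arXiv:1911.08297).
Delta: none in mechanism — no new technique, object, dictionary or reduction is proposed. What the
route adds is bookkeeping of value to the other PneNP routes: (i) refuter-audited Lean statements of
four frontier bits over the tree's CplxCore classes  [refs: 10.1145/3519935.3519976, 10.1145/3188745.3188910, 10.1109/ccc.2009.21, 2503.24061, 1911.08297, doi:10.1145/3519935.3519976, doi:10.1145/3188745.3188910, doi:10.1109/ccc.2009.21, MurrayWilliams2018, LiYang2022, Williams2014, HiraharaLuRen2023, AroraBarak2009, Jukna2012, Kannan1982]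

Barriers (technique_class: algorithmic-method, gate-elimination, diagonalization): - Literature.Barriers.PneNP.Relativization: does not bite on the filed statements as such (X and
cruxes #2–#5 are non-uniform circuit lower bounds for explicit NP functions) but on METHODS: pure
diagonalization/simulation (the Kannan-style ancestry of #4) relativizes and cannot reach NP; the
intended tools are non-relativizing — the algorithmic method "relies on an efficient ACC
satisfiability algorithm, which uses non-relativizing properties of ACC circuits" (Williams2014 p.7)
and gate elimination analyses the circuit itself. The Assembly is a relativizing 6-line implication,
harmless since it assumes X.
- Literature.Barriers.PneNP.BoundedRelativization: any PSPACE-relativizing proof of the summit shape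
is excluded (HiraharaLuRen2023 §1.1, Prop. 1); not evaded by design — the bet is that an explicit
circuit lower bound (cruxes #2–#5) is proved by white-box analysis of circuits (SAT algorithms for
the class, gate elimination, polynomial method), which is not reasoning relative to a PSPACE oracle;
HLR2023 p.10 additionally records that pushing the Kannan/Santhanam fixed-polynomial bounds
(ancestors of #4) to almost-everywhere is beyond PSPACE-relativizing techniques.
- Literature.Barriers.PneNP.Algebrization: bites squarely — AW Thm 5.6 / fact
Algebrization_npLinearSize: NP ⊄ SIZE(O(n)) (crux #2), hence the Kannan form of #4 and X, admit no
algebrizing proof; not evaded by any filed statement; the bet is the algorithmic method, which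
"circumvents relativization and algebrizati

Novelty grade: known — ROUTE REVIEW (refuter-rreview1-PneNP-circuit-9592353c-0, 08-15). NOVELTY known — route says so ('Delta: none in mechanism'): X = NP ⊄ P/poly (AB09 §6.4); cruxes are the published frontier one notch up (LiYang22 3.1n−o(n); Williams14/MW18; Kannan82/FSW09). lit searchd down at review (rc 75 ×2): grade (refuter refuter-rreview1-PneNP-circuit-9592353c-0, 2026-08-15T18:27:57Z; prior: AroraBarak2009 §6.4, Ch.14, Ch.23, Jukna2012 Thms 20.10-20.13, doi:10.1145/3519935.3519976 (LiYang2022 Thm 1.1), doi:10.1145/2559903 (Williams2014 Thm 1.1), doi:10.1145/3188745.3188910 (MurrayWilliams2018 Thm 1.3), doi:10.1016/s0019-9958(82)90382-5 (Kannan1982 Thm 2), doi:10.1109/ccc.2009.21 (Fortnow-Santhanam-Williams 2009), arXiv:2503.24061 §1.1, KarpLipton1980)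

History (route lifecycle, newest last):
- 2026-08-15T16:23:22Z · rev 4: restated CircuitThesis (stmt-PneNP-0034), CircuitFixedPoly (stmt-PneNP-0038) — route-repair 1/2 (rbadge-PneNP-circuit-9592353c-g2): imports += NPBridge, CircuitClassesUniformProofs (needed by the deciding theorem); restate target CircuitTh (planner-rbadge-PneNP-circuit-9592353c-g2-0)
- 2026-08-15T17:00:58Z · rev 5: restated Assembly (stmt-PneNP-0035) — route-repair 2/2 (rbadge-PneNP-circuit-9592353c-g2): DECIDING THEOREM `closes (hX : CircuitThesis) : PneNP` (D-0027 §2.1) — NP ⊄ P/poly → P ≠ NP through the PRO (planner-rbadge-PneNP-circuit-9592353c-g2-0)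
- 2026-08-16T04:14:44Z · AUTO-CRUX (backfill): CircuitThesis — hypotheses of the deciding theorem that nothing in the route derives are cruxes (operator:999:1085951)
- 2026-08-25T10:02:57Z · DORMANT — reconciler: no traction for 7.6 d (last activity item-evidence-added at 2026-08-17T19:10:44Z); parked, not closed — `ledger route dormant route-PneNP-circuit -- (operator:999:2656398)

sub-problem: PneNP · status: dormant · opened planner-PneNP-plan-0 2026-08-13T05:47:47Z · rev 5 · ledger route-PneNP-circuit
GENERATED by the gate from the ledger (D-0016/17). Provers cite these decls: `theorem foo : Summit.PneNP.PneNP.Theses.Circuit.<Decl> := …` in Summits/PneNP/PneNP/Theorems/<Name>.lean.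
-/

namespace Summit.PneNP.PneNP.Theses.Circuit

open scoped BigOperators Topology Manifold Classical MeasureTheory ProbabilityTheory Matrix InnerProductSpace ComplexConjugate ContinuousMap
open Filter Set Function TopologicalSpace MeasureTheory

attribute [summit_statement] _root_.PneNP

open Literature.PNP

-- earlier CircuitThesis (stmt-PneNP-0034, replaced 2026-08-15T16:23:22Z -> stmt-PneNP-10624): retired by None — Literature.Computability.Complexity.NPNotSubsetPPoly
/-- item stmt-PneNP-10624 · crux (kind.auto-crux: conjecture-grade) · rank 0 · open · by planner
why it might fail: ¬X = NP ⊆ P/poly (item CircuitNeg) is open and contradicts nothing proved: its only established cost is PH = Σ₂ᵖ (karp_lipton_holds; AB09 Thm 6.19). Every lower-bound technique in hand is natural (RR97 Thm 4.1: kills X if 2^{k^ε}-hard PRGs exist) or algebrizes (AW09 Thm 5.6 covers NP ⊄ SIZE(O(n))).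
sources: CookClay2006 §3 (posed: super-polynomial circuit lower bound for 3-SAT); KarpLipton1980; AroraBarak2009 Thm 6.19 (PDF p.142), §6.4 p.144; in-tree Literature.Computability.Complexity.karp_lipton_holds, RazborovRudich1997 Thm 4.1 = Literature.Barriers.PneNP.NaturalProofs (NaturalProofs.no_naturalProof_for), AaronsonWigderson2009 Thm 5.6 = Literature.Barriers.PneNP.Algebrization (fact Literature.Barriers.PneNP.Algebrization_npLinearSize), arXiv:2503.24061 §1.1 p.3 ('NP ⊄ P/poly seems out of reach of current techniques; not even fixed-polynomial bounds for NE and formulas')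
Route thesis X of PneNP/Circuit: some language in NP is decided by no polynomial-size family of
Boolean circuits [CookClay2006 §3; KarpLipton1980; AroraBarakCC2009 §6.4]. Stated INLINE — rfl-equal
to the registered open statement `Literature.Computability.Complexity.NPNotSubsetPPoly` (pnp.S02),
which is deliberately not referenced so that no open named fact sits in the route's dependency cone.
Decided by the route's `closes : CircuitThesis → PneNP` (rev 2: P_bool_eq_holds, NP_bool_eq_holds,
P_subset_PPoly_holds). Crux #2 reaches it through `CircuitMcspGlue`. -/
@[route_item "route-PneNP-circuit", crux]
def CircuitThesis : Prop :=
  ¬ (Literature.Computability.Complexity.Nondeterministic.NP ⊆ Literature.Computability.Complexity.PPoly)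

/-- item stmt-PneNP-0036 · crux · rank 2 · open · by planner
why it might fail: NP ⊆ SIZE(O(n)) is consistent with all we know (frontier 3.1n−o(n), LiYang2022 Thm 1.1). Gate elimination, 'our only weapon', provably stalls at c·n, c tied to substitutions per step (GHKK16 Lem 1, Cor 7; LiYang2022 p.4); other proofs must be non-natural if OWF exist (RR97), non-algebrizing (AW09).
sources: LiYang2022 Thm 1.1 (p.2) and §1.2 p.4, doi:10.1145/3519935.3519976; in-tree fact Literature.Computability.Complexity.li_yang, GolovnevHirschKnopKulikov2016 Lemma 1, Thm 3, Cor 7 = Literature.Barriers.PneNP.GateEliminationLimit, RazborovRudich1997 Thm 4.1 = Literature.Barriers.PneNP.NaturalProofs, AaronsonWigderson2009 Thm 5.6 (fact Literature.Barriers.PneNP.Algebrization_npLinearSize: NP ⊄ SIZE(O(n)) does not algebrize), AroraBarak2009 p.343 ('unable to prove even a superlinear circuit lower bound for any NP problem')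
Some NP language has B2-circuit complexity that is not O(n) (infinitely often above c·n for every
c). Open since the 1970s; frontier is 3.1n − o(n) for affine dispersers (Li–Yang, STOC2022;
Literature fact li_yang). Follows from X via mem_SIZE_iff_circuitSize_le. Any proof must evade
Razborov–Rudich naturalness if OWF exist (RazborovRudich1997). Sources: STOC2022,
RazborovRudich1997, AroraBarak2009. -/
@[route_item "route-PneNP-circuit"]
def CircuitSuperlinear : Prop :=
  ∃ L ∈ Literature.Computability.Complexity.Nondeterministic.NP, ∀ c : ℕ, ∃ᶠ n in Filter.atTop, c * n < Language.circuitSize L n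

/-- item stmt-PneNP-0037 · crux · rank 3 · open · by planner
why it might fail: Non-uniform ACC⁰ ⊇ NP contradicts nothing known. The algorithmic method diagonalises via the NTIME hierarchy and bottoms out at NQP (MW18 Thm 1.3); even nondeterministic 2^{(1−ε)n} GAP-ACC-UNSAT gives only NTIME[n^{ck⁴/ε}] ⊄ ACC⁰-SIZE(n^k) (MW18 Thm 1.1), never NP vs all poly sizes.
sources: MurrayWilliams2018 Thm 1.1 and Thm 1.3 (p.4), doi:10.1145/3188745.3188910, Williams2014 Thm 1.1 (p.3) and p.7, doi:10.1145/2559903; in-tree fact Literature.Computability.Complexity.williams_acc, Literature.Barriers.PneNP.CompositeModulusDegree (Razborov–Smolensky degree method fails for composite moduli; compositeModulusDegree_holds), AroraBarak2009 §14.4.2 (PDF p.359): 'we would like to show even a function in P or NP that is not in ACC0'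
Open. Known: NEXP ⊄ ACC⁰ (Williams, ACM2014; Literature fact williams_acc) and NQP ⊄ ACC⁰
(Murray–Williams, STOC 2018) by the algorithmic method; pushing the easy-witness lemma from NQP down
to NP is the gap. Follows from X via ACC0 ⊆ TC0 ⊆ NC1 ⊆ PPoly. Sources: ACM2014, Hastad1986,
AroraBarak2009. -/
@[route_item "route-PneNP-circuit"]
def CircuitNpAcc0 : Prop :=
  ¬ (Literature.Computability.Complexity.Nondeterministic.NP ⊆ Literature.Computability.Complexity.ACC0)

/-- item stmt-PneNP-0039 · crux · rank 5 · open · by planner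
why it might fail: Even NEXP ⊄ TC⁰ is open. TC⁰ evaluates Naor–Reingold PRFs, so under subexponential DDH/factoring hardness no natural property is useful against TC⁰ (NR04 p.7; NaturalProofsTC0, proved in-tree modulo HardPRFInTC0); SAT-based bounds reach only ACC⁰∘THR, one threshold layer (MW18 Thm 1.3).
sources: NaorReingold2004 p.7, Construction 4.1 / Thm 4.5, doi:10.1145/972639.972643, Literature.Barriers.PneNP.NaturalProofsTC0 (naturalProofsTC0_holds; hypothesis Literature.Barriers.PneNP.HardPRFInTC0); RazborovRudich1997 Thm 4.1, AroraBarak2009 Ch.23 notes (PDF p.596): natural proofs 'will probably not allow us to separate even TC0 from P', MurrayWilliams2018 Thm 1.3 (p.4): NQP ⊄ ACC∘THR only, doi:10.1145/3188745.3188910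
Open (even NEXP ⊄ TC⁰ is open). Sits between #3 and X: X → #5 via TC0_subset_NC1, NC1_subset_PPoly;
#5 → #3 via ACC0_subset_TC0. Natural-proofs barrier applies in full if TC⁰ computes PRFs
(Naor–Reingold; RazborovRudich1997). Sources: RazborovRudich1997, AroraBarak2009. -/
@[route_item "route-PneNP-circuit"]
def CircuitNpTc0 : Prop :=
  ¬ (Literature.Computability.Complexity.Nondeterministic.NP ⊆ Literature.Computability.Complexity.TC0)

-- earlier CircuitFixedPoly (stmt-PneNP-0038, replaced 2026-08-15T16:23:22Z -> stmt-PneNP-10761): retired by None — ∀ k : ℕ, ∃ L ∈ Literature.Computability.Complexity.Nondeterministic.NP, L ∉ Literature.Computability.Complexity.SIZE (fun n => n ^ k)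
/-- item stmt-PneNP-10761 · support · rank 4 · open · by planner
why it might fail: Open even for NE and for formulas (arXiv:2503.24061 §1.1). Kannan's census argument needs Σ₂ᵖ-power NP lacks; PSPACE-relativizing techniques cannot even make the Σ₂ᵖ/pr-MA bounds almost-everywhere (HiraharaLuRen2023 p.10); non-relativizing, non-algebrizing (AW09 Thm 5.6) proof required.
sources: Kannan1982 Thm 2 (Information and Control 55, p.44), doi:10.1016/s0019-9958(82)90382-5; in-tree fact Literature.Computability.Complexity.kannan / kannan_holds (StructuralPHProofs.lean:172), same c*n^k+c rendering, Fortnow–Santhanam–Williams, Fixed-Polynomial Size Circuit Bounds, CCC 2009, doi:10.1109/ccc.2009.21, HiraharaLuRen2023 p.10, doi:10.4230/lipics.ccc.2023.6, arXiv:2503.24061 §1.1 (no fixed-polynomial size lower bounds known even for NE and formulas), Summits/PneNP/PneNP/Theorems/CircuitRefutations.lean: Summit.PneNP.Circuit.SIZE_pow_eq_empty, fixedPoly_literal_iff (why the literal SIZE(n^k) form was degenerate)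
[support] Fixed-polynomial circuit lower bounds for NP, KANNAN FORM: for every k some NP language
has no B₂-circuit family of size c·n^k + c for any constant c (NP ⊄ SIZE(O(n^k)) for each fixed k;
size bound rendered exactly as in the in-tree fact `kannan`). Open; known one level up: Σ₂ᵖ ∩ Π₂ᵖ
(Kannan1982 Thm 2 = kannan_holds), later S₂P, PP, MA/1 (Fortnow–Santhanam–Williams CCC 2009).
Immediate from X via SIZE_subset_PPoly (checked in the planner's Sketch, rc 0), so it is a genuine
waypoint; independent of #2 formally (the witness may vary with k). SUPERSEDES the degenerate
literal form `L ∉ SIZE (fun n => n ^ k)` (SIZE(n^k) = ∅ for k ≥ 1 because Fin-0-input circuits have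
≥ 1 gate: Theorems/CircuitRefutations.lean, SIZE_pow_eq_empty / fixedPoly_literal_iff), as requested
by retriage 2026-08-14 and route-repair 2026-08-15. Sources: Kannan1982, doi:10.1109/ccc.2009.21,
HiraharaLuRen2023, arXiv:2503.24061. -/
@[route_item "route-PneNP-circuit"]
def CircuitFixedPoly : Prop :=
  ∀ k : ℕ, ∃ L ∈ Literature.Computability.Complexity.Nondeterministic.NP, L ∉ ⋃ c : ℕ, Literature.Computability.Complexity.SIZE (fun n => c * n ^ k + c)

/-- item stmt-PneNP-0040 · support · rank 6 · open · by planner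
why it might fail: Widely expected to be FALSE: NP ⊆ P/poly collapses PH to Σ₂ᵖ (Karp–Lipton–Sipser; in-tree karp_lipton_holds) — it is the literal negation of target 0034, filed as the route's kill switch.
sources: KarpLipton1980; AroraBarak2009 Thm 6.19 (PDF p.142); in-tree Literature.Computability.Complexity.karp_lipton_holds, Jukna2012 Thm 20.10 (p.577)
Negation of the thesis, filed so the negative side is staffed. If proved, PH collapses to Σ₂
(KarpLipton1980) and route circuit closes. Sources: KarpLipton1980. -/
@[route_item "route-PneNP-circuit"]
def CircuitNeg : Prop :=
  Literature.Computability.Complexity.Nondeterministic.NP ⊆ Literature.Computability.Complexity.PPoly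

-- earlier Assembly (stmt-PneNP-0035, replaced 2026-08-15T17:00:58Z -> stmt-PneNP-10625): retired by None — Literature.Computability.Complexity.P_bool_eq → Literature.Computability.Complexity.NP_bool_eq → Literature.Computability.Complexity.P_subset_PPoly → Literature.Computability.Complexity.NPNotSubsetPPoly → PneNP
/-- item stmt-PneNP-10625 · assembly · rank 1 · closed · proved by Summit.PneNP.PneNP.Theorems.circuit_assembly_standalone (prover) · by planner
Assembly for route Circuit (rev 2): the thesis X = `CircuitThesis` (¬(NP ⊆ P/poly)) implies the
summit statement `PneNP`. Proved inside the route file as the deciding theorem `closes` from the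
discharged model bridges `Literature.Computability.Complexity.P_bool_eq_holds`, `NP_bool_eq_holds`
and `P ⊆ P/poly` = `P_subset_PPoly_holds` [AroraBarakCC2009 Thm 6.6, §6.4]; any prover closes this
item with `theorem … : Assembly := fun hX => Summit.PneNP.PneNP.Theses.Circuit2.closes hX`. Replaces
the rev-1 form whose hypotheses were those Literature facts themselves (unlisted items =
glue.extra-hypothesis). [sources: AroraBarakCC2009 §6.4, Thm 6.6; CookClay2006 §3] -/
@[route_item "route-PneNP-circuit"]
def Assembly : Prop :=
  CircuitThesis → PneNP

/-! D-0027 §2.1 — DECIDING THEOREM (planner-authored via `route open/edit --closes-file`; by planner-rbadge-PneNP-circuit-9592353c-g2-0 2026-08-15T17:00:58Z):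
its hypotheses are this route's items and its conclusion the sub-problem Statement (glue_lint), and it elaborates with this file. -/

@[closes "route-PneNP-circuit"] theorem closes (hX : CircuitThesis) : PneNP := by
  -- D-0027 §2.1 deciding theorem of route-PneNP-circuit: NP ⊄ P/poly → P ≠ NP (Arora–Barak 2009 §6.4).
  -- Only the route's target item `CircuitThesis` is a hypothesis; the model bridges and P ⊆ P/poly enter as
  -- PROVED Literature theorems: `P_bool_eq_holds` (ClayProblem), `np_bool_eq` (NPBridge; = NP_bool_eq_holds),
  -- `P_subset_PPoly_holds` (CircuitClassesUniformProofs). Axioms: propext, Classical.choice, Quot.sound.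
  by_contra h
  have hP : Literature.Computability.Complexity.PNPWave0.P Bool = Literature.Computability.Complexity.Classes.P :=
    Literature.Computability.Complexity.P_bool_eq_holds
  have hN : Literature.Computability.Complexity.PNPWave0.NP Bool = Literature.Computability.Complexity.Nondeterministic.NP :=
    Literature.Computability.Complexity.np_bool_eq
  apply hX
  intro L hL
  have hLP : L ∈ Literature.Computability.Complexity.PNPWave0.P Bool := by
    by_contra hL'
    exact h ⟨L, hN ▸ hL, hL'⟩
  exact Literature.Computability.Complexity.P_subset_PPoly_holds (hP ▸ hLP)

end Summit.PneNP.PneNP.Theses.Circuit
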